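import Summits.BirchSwinnertonDyer.BirchSwinnertonDyer.Theorems.RamifiedSevenEllipticUnitsRigidityCoefficients
import Literature.NumberTheory.EllipticCurves.CMNewformHeckeRecursionProofs
import Literature.NumberTheory.LFunctions.RayClassOrthogonality
import HarnessLib

set_option linter.dupNamespace false
set_option autoImplicit false

/-!
# Rigidity bridge (R2, second half): at a split prime, equal Hecke `L`-functions have equal VALUE PAIRS

Helper file for the K7r Value crux `EllipticUnitValueSevenOfGZK` (stmt-BirchSwinnertonDyer-19945), line
`rubin-formula-zp` v4.1, registered stub H_Rig `stub_pinnedCharacterStructureSeven`. Files (R1)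
(`…RigidityDirichlet`) and (R2a) (`…RigidityCoefficients`) turn `heckeLFunction φ = heckeLFunction ψ`
on a half-plane into the equality of the weighted coefficient functions
`n ↦ (Σ_{N𝔞 = n} φ₀(𝔞))·n^{−σ_φ}`. This file reads that identity at `n = ℓ` and `n = ℓ²` for a rational
prime `ℓ` which SPLITS as `w₁ w₂` in the quadratic field `K` (both places of residue degree one) and is
prime to both ramification moduli: the ideals of norm `ℓ^e` are the `w₁^i w₂^{e−i}` (tree, Ribet 1977
§3 proofs: `ModularForms.finsum_absNorm_eq_prime_pow_of_pair`), so the identities are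
`φ(w₁) + φ(w₂) = ψ(w₁) + ψ(w₂)` and `φ(w₁)² + φ(w₁)φ(w₂) + φ(w₂)² = ψ(w₁)² + ψ(w₁)ψ(w₂) + ψ(w₂)²`
(`φ₀(w)·ℓ^{−σ_φ} = φ(w)` since `Nw = ℓ`), whence `φ(w₁)φ(w₂) = ψ(w₁)ψ(w₂)` and by Vieta the unordered
pairs agree: `valuePair_eq_of_heckeLFunction_eq`. This is the input of the seat's file
`…LemmaXiValuePairs` ((P1)/(P5) for `φ` from the value pairs) and of (R3).

References: Ribet, LNM 601 (1977) §3; Neukirch, *Algebraic Number Theory*, VII (8.1).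
-/

noncomputable section

open scoped Classical
open Filter NumberField IsDedekindDomain
  Literature.NumberTheory.GaloisRepresentations
  Literature.NumberTheory.LFunctions
  Literature.NumberTheory.EllipticCurves.ModularForms

namespace Summit.BirchSwinnertonDyer.BirchSwinnertonDyer.Theorems.RamifiedSevenEllipticUnits

namespace Rigidity

variable {K : Type} [Field K] [NumberField K]

/-- `twistCount ν n = ∑ᶠ_{N𝔞 = n} ν(𝔞)`. [folklore] -/
theorem twistCount_eq_finsum (ν : Ideal (𝓞 K) →*₀ ℂ) (n : ℕ) :
    NumberField.twistCount K ν n = ∑ᶠ I ∈ {I : Ideal (𝓞 K) | Ideal.absNorm I = n}, ν I := by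
  rw [NumberField.twistCount, NumberField.idealsOfNorm,
    ← finsum_mem_coe_finset, Set.Finite.coe_toFinset]

/-- The coefficient function `rayClassCoeffHom 𝔪 ψ` at a prime `w ∤ 𝔪` is `ψ w`. [cite: NeukirchANT1999, Ch. VII §8 (8.1)] -/
theorem rayClassCoeffHom_asIdeal {𝔪 : Ideal (𝓞 K)} (ψ : HeightOneSpectrum (𝓞 K) → ℂ)
    {w : HeightOneSpectrum (𝓞 K)} (hw : ¬ 𝔪 ≤ w.asIdeal) (h𝔪 : 𝔪 ≠ ⊥) :
    rayClassCoeffHom 𝔪 ψ w.asIdeal = ψ w := by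
  rw [rayClassCoeffHom_apply, rayClassCoeff, if_pos ⟨w.ne_bot, isCoprime_asIdeal_of_not_le h𝔪 hw⟩,
    idealPow_asIdeal]

/-- **Vieta for a pair**: equal sums and equal products give equal unordered pairs. [folklore] -/
theorem pair_eq_of_sum_eq_of_mul_eq {a b c d : ℂ} (hs : a + b = c + d) (hp : a * b = c * d) :
    (a = c ∧ b = d) ∨ (a = d ∧ b = c) := by
  have h : (a - c) * (a - d) = 0 := by linear_combination a * hs - hp
  rcases mul_eq_zero.mp h with h1 | h1
  · left
    refine ⟨sub_eq_zero.mp h1, ?_⟩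
    have := sub_eq_zero.mp h1
    linear_combination hs - this
  · right
    refine ⟨sub_eq_zero.mp h1, ?_⟩
    have := sub_eq_zero.mp h1
    linear_combination hs - this

/-- **Equal Hecke `L`-functions ⇒ equal value pairs at a split prime.** `K` quadratic; `φ`, `ψ` Hecke
characters with `heckeLFunction φ s = heckeLFunction ψ s` for `re s > s₀`; `v` a rational place
unramified in `K` that splits as `{w₁, w₂}` (both of residue degree one), with `φ` and `ψ` unramified
at `w₁`, `w₂`. Then `{φ(ϖ_{w₁}), φ(ϖ_{w₂})} = {ψ(ϖ_{w₁}), ψ(ϖ_{w₂})}` as unordered pairs.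
[cite: Ribet1977Nebentypus, §3 Thm. (3.4)] [cite: NeukirchANT1999, Ch. VII §8 (8.1)] -/
theorem valuePair_eq_of_heckeLFunction_eq (φ ψ : HeckeCharacter K) (s₀ : ℝ)
    (h : ∀ s : ℂ, s₀ < s.re → heckeLFunction φ s = heckeLFunction ψ s)
    (v : HeightOneSpectrum (𝓞 ℚ)) {w₁ w₂ : HeightOneSpectrum (𝓞 K)} (hne : w₁ ≠ w₂)
    (hS : {w : HeightOneSpectrum (𝓞 K) | w.asIdeal.under (𝓞 ℚ) = v.asIdeal} = {w₁, w₂})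
    (h₁ : w₁.asIdeal.inertiaDeg (𝓞 ℚ) = 1) (h₂ : w₂.asIdeal.inertiaDeg (𝓞 ℚ) = 1)
    (hφ₁ : φ.IsUnramifiedAt w₁) (hφ₂ : φ.IsUnramifiedAt w₂)
    (hψ₁ : ψ.IsUnramifiedAt w₁) (hψ₂ : ψ.IsUnramifiedAt w₂) :
    (φ.valueAtUniformizer w₁ = ψ.valueAtUniformizer w₁ ∧ φ.valueAtUniformizer w₂ = ψ.valueAtUniformizer w₂) ∨
    (φ.valueAtUniformizer w₁ = ψ.valueAtUniformizer w₂ ∧ φ.valueAtUniformizer w₂ = ψ.valueAtUniformizer w₁) := by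
  obtain ⟨σ₁, φ₀, 𝔪₁, σ₂, ψ₀, 𝔪₂, -, h𝔪₁, -, hiff₁, -, hval₁, -, h𝔪₂, -, hiff₂, -, hval₂, hcoeff⟩ :=
    weightedCoeff_eq_of_heckeLFunction_eq φ ψ s₀ h
  set ℓ : ℕ := Rat.HeightOneSpectrum.natGenerator v with hℓ
  have hℓp : ℓ.Prime := Rat.HeightOneSpectrum.prime_natGenerator v
  have hℓ0 : (ℓ : ℂ) ≠ 0 := by exact_mod_cast hℓp.ne_zero
  -- the coefficient functions as finsums over ideals of norm `ℓ^e`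
  set g₁ : Ideal (𝓞 K) →*₀ ℂ := rayClassCoeffHom 𝔪₁ fun v ↦ φ₀.valueAtUniformizer v
  set g₂ : Ideal (𝓞 K) →*₀ ℂ := rayClassCoeffHom 𝔪₂ fun v ↦ ψ₀.valueAtUniformizer v
  have hmul : ∀ (g : Ideal (𝓞 K) →*₀ ℂ) (A B : Ideal (𝓞 K)), A ≠ ⊥ → B ≠ ⊥ → g (A * B) = g A * g B :=
    fun g A B _ _ ↦ map_mul g A B
  have hone : ∀ g : Ideal (𝓞 K) →*₀ ℂ, g ⊤ = 1 := fun g ↦ by rw [← Ideal.one_eq_top, map_one]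
  have hsum : ∀ (g : Ideal (𝓞 K) →*₀ ℂ) (e : ℕ), NumberField.twistCount K g (ℓ ^ e) =
      ∑ i ∈ Finset.range (e + 1), g w₁.asIdeal ^ i * g w₂.asIdeal ^ (e - i) := by
    intro g e
    rw [twistCount_eq_finsum, hℓ]
    exact finsum_absNorm_eq_prime_pow_of_pair g (hmul g) (hone g) v hne hS h₁ h₂ e
  -- values of the coefficient functions at `w₁`, `w₂`
  have hg₁₁ : g₁ w₁.asIdeal = φ₀.valueAtUniformizer w₁ :=
    rayClassCoeffHom_asIdeal _ ((hiff₁ w₁).mp hφ₁) h𝔪₁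
  have hg₁₂ : g₁ w₂.asIdeal = φ₀.valueAtUniformizer w₂ :=
    rayClassCoeffHom_asIdeal _ ((hiff₁ w₂).mp hφ₂) h𝔪₁
  have hg₂₁ : g₂ w₁.asIdeal = ψ₀.valueAtUniformizer w₁ :=
    rayClassCoeffHom_asIdeal _ ((hiff₂ w₁).mp hψ₁) h𝔪₂
  have hg₂₂ : g₂ w₂.asIdeal = ψ₀.valueAtUniformizer w₂ :=
    rayClassCoeffHom_asIdeal _ ((hiff₂ w₂).mp hψ₂) h𝔪₂
  -- norms of `w₁`, `w₂` are `ℓ`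
  have hN : ∀ {w : HeightOneSpectrum (𝓞 K)}, w ∈ ({w₁, w₂} : Set (HeightOneSpectrum (𝓞 K))) →
      w.asIdeal.inertiaDeg (𝓞 ℚ) = 1 → ((Ideal.absNorm w.asIdeal : ℕ) : ℂ) = ℓ := by
    intro w hw hf
    have hw' : w.asIdeal.under (𝓞 ℚ) = v.asIdeal := by rw [← hS] at hw; exact hw
    have := (absNorm_eq_natGenerator_iff (K := K) v w.asIdeal).mpr ⟨w, rfl, hw', hf⟩
    rw [this]
  have hN₁ : ((Ideal.absNorm w₁.asIdeal : ℕ) : ℂ) = ℓ := hN (by simp) h₁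
  have hN₂ : ((Ideal.absNorm w₂.asIdeal : ℕ) : ℂ) = ℓ := hN (by simp) h₂
  -- abbreviations for the eight values
  set a := φ.valueAtUniformizer w₁
  set b := φ.valueAtUniformizer w₂
  set c := ψ.valueAtUniformizer w₁
  set d := ψ.valueAtUniformizer w₂
  have ha : φ₀.valueAtUniformizer w₁ = a * (ℓ : ℂ) ^ (σ₁ : ℂ) := by rw [hval₁, hN₁]
  have hb : φ₀.valueAtUniformizer w₂ = b * (ℓ : ℂ) ^ (σ₁ : ℂ) := by rw [hval₁, hN₂]
  have hc : ψ₀.valueAtUniformizer w₁ = c * (ℓ : ℂ) ^ (σ₂ : ℂ) := by rw [hval₂, hN₁]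
  have hd : ψ₀.valueAtUniformizer w₂ = d * (ℓ : ℂ) ^ (σ₂ : ℂ) := by rw [hval₂, hN₂]
  -- the weights: `u = ℓ^σ ≠ 0`, `ℓ^{−σ} = u⁻¹`, `(ℓ²)^{−σ} = u⁻¹·u⁻¹`
  have hu : ∀ σ : ℝ, (ℓ : ℂ) ^ (σ : ℂ) ≠ 0 := fun σ h0 ↦
    hℓ0 (Complex.cpow_eq_zero_iff _ _ |>.mp h0).1
  have hw1 : ∀ σ : ℝ, ((ℓ : ℕ) : ℂ) ^ (-(σ : ℂ)) = ((ℓ : ℂ) ^ (σ : ℂ))⁻¹ := fun σ ↦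
    Complex.cpow_neg _ _
  have hw2 : ∀ σ : ℝ, ((ℓ ^ 2 : ℕ) : ℂ) ^ (-(σ : ℂ)) = ((ℓ : ℂ) ^ (σ : ℂ))⁻¹ * ((ℓ : ℂ) ^ (σ : ℂ))⁻¹ := by
    intro σ
    rw [pow_two, Nat.cast_mul, Complex.natCast_mul_natCast_cpow, Complex.cpow_neg]
  -- the coefficient sums at `ℓ` and `ℓ²`
  have hs1 : ∀ g : Ideal (𝓞 K) →*₀ ℂ, NumberField.twistCount K g ℓ = g w₂.asIdeal + g w₁.asIdeal := by
    intro g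
    have := hsum g 1
    rw [pow_one] at this
    rw [this, Finset.sum_range_succ, Finset.sum_range_succ, Finset.sum_range_zero]
    simp
  have hs2 : ∀ g : Ideal (𝓞 K) →*₀ ℂ, NumberField.twistCount K g (ℓ ^ 2) =
      g w₂.asIdeal ^ 2 + g w₁.asIdeal * g w₂.asIdeal + g w₁.asIdeal ^ 2 := by
    intro g
    rw [hsum g 2, Finset.sum_range_succ, Finset.sum_range_succ, Finset.sum_range_succ,
      Finset.sum_range_zero]
    simp
  -- read the weighted identities
  have e1 := hcoeff ℓ hℓp.ne_zero
  have e2 := hcoeff (ℓ ^ 2) (pow_ne_zero 2 hℓp.ne_zero)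
  rw [hs1, hs1, hg₁₁, hg₁₂, hg₂₁, hg₂₂, ha, hb, hc, hd, hw1, hw1] at e1
  rw [hs2, hs2, hg₁₁, hg₁₂, hg₂₁, hg₂₂, ha, hb, hc, hd, hw2, hw2] at e2
  have hsum' : a + b = c + d := by
    have hu₁ := hu σ₁; have hu₂ := hu σ₂
    field_simp at e1
    linear_combination e1
  have hsq : a ^ 2 + a * b + b ^ 2 = c ^ 2 + c * d + d ^ 2 := by
    have hu₁ := hu σ₁; have hu₂ := hu σ₂
    field_simp at e2
    linear_combination e2
  have hprod : a * b = c * d := by linear_combination (a + b + c + d) * hsum' - hsq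
  exact pair_eq_of_sum_eq_of_mul_eq hsum' hprod

end Rigidity

end Summit.BirchSwinnertonDyer.BirchSwinnertonDyer.Theorems.RamifiedSevenEllipticUnits

end
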